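import Literature.MathematicalPhysics.QuantumFieldTheory.Balaban1983to89.Node00.TorusCoverCubeMemberPrintZd
import Literature.MathematicalPhysics.QuantumFieldTheory.Balaban1983to89.Node00.TorusCoverLandau153RecInGauge
import Literature.MathematicalPhysics.QuantumFieldTheory.Balaban1983to89.Node00.TorusCoverLandau153RE
import Literature.MathematicalPhysics.QuantumFieldTheory.Balaban1983to89.Node00.TorusCoverLandau153REFiner
import Literature.MathematicalPhysics.QuantumFieldTheory.Balaban1983to89.Node00.DomainsRefinement
import Literature.MathematicalPhysics.QuantumFieldTheory.Balaban1983to89.Node00.DomainsMeet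

/-!
# NODE 00 — THE R7 DOOR, STAGE 3b: [Balaban1985Variational] (153) AT THE RECORD's TORUS FOR EVERY GAUGE TEST FUNCTION OF THE PRINT DATUM's TORUS TOWER, FROM THE RECORD's
# LANDAU FORM `IsLandau138Z` (dag-n05-d's centred multiplier form) OF THE DOOR's LIFT — this lineage's g2 `TorusCoverLandau153CubeDomains ∕ RE` FOR THE RECORD DATUM `propCubePZ`,
# via g9's FILES 43–44 (`TorusCoverLandau153RecBlocks ∕ RecInGauge`) and dag-n07-e's `rows153_h0∕hQ_cubeDomains` read at the translated labels

Cell `pub-ymgap`, width seat `pub-ymgap-dag-n07-w3` g10 (N05-REC R7 pen; LEAD PEN dag-n05-e).  NEW leaf, THEOREMS ONLY.  CONSUMED BY NAME, nothing modified: this seat's STAGE 3a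
`Node00.TorusCoverCubeMemberPrintZd.propCubePZ` (the record datum over the constant family `Ω′ ≡ □̃ᶻ`), `Node00.CarriersB8CubeDentedRec` (`CubeB8DZ.lamS`), g9's FILE 44
`sum_laplace_mul_diverg_re∕im_eq_zero_of_isLandau138Z_cover` (the (153) pairing on the torus from `IsLandau138Z` under the top-anchored translate, with the two μ-rows `h0 ∕ hQ` displayed),
dag-n07-e's module 39 `Node00.TorusCoverCubeDomains` (`cubeDomains`, `support_row_cubeDomains`, ★ `rows153_h0_cubeDomains`, ★ `rows153_hQ_cubeDomains` — the μ-rows at the ENGINE cells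
`cubeLamS … k k j`), this lineage's g2∕g3 `Node00.TorusCoverLandau153RE` letters (`RE_eq_zero_iff`, `mem_ker_QpE_iff`, `inner_eq_sum`, `lapE_apply`, `dsE_apply`) and `…REFiner`'s
`RE_eq_zero_of_ker_le`, dag-n07-e's `DomainsRefinement.ker_QpE_le_of_domainsLe` ∕ `DomainsMeet.domainsMeet_le_left`, the (T2) dictionary `B8Eq131CubesRecDictionary`, dag-n05-d's
`B8Eq131CubesRec` ∕ `B8Eq119TwistedAxialRec.underZ_tower`, N05's `B8Eq131CubesAdmissible.add_mem_cube_of_mem_succ`, `B8CubeMemberZd.cubeLamS_top ∕ cubeLam`.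
`--kind proof --supports stmt-QuantumFields-20541` (K0⁷; count-neutral).  [15] = [Balaban1985Variational]; [6] = [Balaban1985RegularSpaces]; [B6] = [Balaban1984PropagatorsII]; [I] = [Balaban1987RG1].

THE POINT.  STAGE 2's door (`exists_localGauge152_recTower_member`, FILE 7) delivers the torus potential `A` with `A ⟨π(x + c_k·𝟙), μ⟩ = A″ x μ` on `□̃ᶻ` and the RECORD's (153)
`IsLandau138Z L k η_n Ω′₀ Λ′ 1 A″` for the record cells `Λ′ = (propCubePZ …).lamS` — dag-n05-d's multiplier form over CENTRED blocks.  N07's `HThm4Rec` asks for [15] (153) in lit-balaban's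
torus letters: `RE (domainsMeet (cubeDomains P (cornerP …) (sideP …) ρ k hk) (domainsOfSeq s.Ω k hk)) η⁻¹ (dsE η⁻¹ (Re∕Im (φ ∘ A))) = 0`.  g9's FILE 44 turns `IsLandau138Z` into the torus pairing
`⟨Δμ, ∂*a⟩ = 0` given two μ-rows at the record cells read at `+c_k` ∕ `+c_{k−j}`; dag-n07-e's module 39 supplies those rows at the ENGINE cells `cubeLamS … k k j` for every `μ ∈ N(Q′)` of the
datum's torus tower `cubeDomains`; §1 here is the one geometric fact joining them — over the constant family `□̃ᶻ` (EMPTY dent) the record datum's dented cells ARE the pure cells, which translate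
onto the engine cells label for label (`add_ctrShift_mem_cubeLamS_of_mem_lamS_propCubePZ`).

WHAT IS PROVED (kernel; `P : Params`, `N ≥ 1`; no definition).
* §1 ★ `mem_lamS_propCubePZ_iff` (`j ≤ k`: the cells of `propCubePZ` are `{z ∈ □_j^{(j)}ᶻ | j < k → z ∉ □_{j+1}^{(j)}ᶻ}` — the two dent clauses are TRUE over `Ω′ ≡ □̃ᶻ`, by dag-n05-d's `underZ_tower`
  and `inner_eq_blowup`), ★ `add_ctrShift_mem_cubeLamS_of_mem_lamS_propCubePZ` (`z ∈ Λ′_j ⇒ z + c_{k−j}·𝟙 ∈ cubeLamS L (cornerP) (sideP) ρ k k j`).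
* §2 ★★★ `sum_laplace_mul_diverg_re∕im_eq_zero_of_isLandau138Z_propCubePZ`: from `IsLandau138Z L k η ((propCubePZ …).sq 0) (propCubePZ …).lamS 1 A″`, the non-wrapping `InjOn π (cube L (cornerP) (sideP) ρ k 0)`
  and `A ⟨π(x + c_k·𝟙), μ⟩ = A″ x μ` on `□₀ᶻ`: `Σ_y (laplace η⁻¹ μ)(y)·(diverg η⁻¹ (Re∕Im(φ∘A)))(y) = 0` for EVERY `μ ∈ N(Q′)` of `cubeDomains P (cornerP …) (sideP …) ρ k hk` and every `φ`.
* §3 ★★★ `RE_dsE_re∕im_eq_zero_of_isLandau138Z_propCubePZ` (p21's letters: `RE (cubeDomains …) η⁻¹ (dsE η⁻¹ (Re∕Im(φ∘A))) = 0`) and ★★★ `RE_dsE_re∕im_eq_zero_meet_of_isLandau138Z_propCubePZ`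
  (the same at EVERY kernel-finer family, in particular at N07's meet `domainsMeet (cubeDomains …) D₂` — `HThm4Rec`'s (153) row shape).
HONEST FRAMING: count-neutral compositions by name over the door's (153)-gauged lift (itself a consequence of the HYPOTHESIS R6 is to conclude); the non-wrapping of `□₀` is DISPLAYED;
nothing of [15] ∕ [6] ∕ [B6] analysis asserted; `HThm4Rec` UNDISCHARGED (caveat (C-S3-1)); N07 ∕ N05 NOT discharged; counts unmoved; one finite 𝕋⁴ programme at fixed ε — R4 closes the
conditional finite-𝕋⁴ rung `BalabanLadder.UV` only; the YM mass gap (Clay) is NOT proved by any of this; nothing continuum ∕ ℝ⁴ ∕ OS.  No `sorry`, no `def`, no `instance`, no `notation`.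

References: [15] (150)–(153) p.301; [6] (1.38) p.82, (1.131) p.99, p.98; [B6] (2.7) p.224, (2.10)–(2.12) p.225; [I] (0.1) p.251, (0.3)–(0.4) pp.252–253.
-/

noncomputable section

namespace Literature.MathematicalPhysics.QuantumFieldTheory.Balaban1983to89.Node00

open scoped BigOperators Matrix.Norms.L2Operator InnerProductSpace RealInnerProductSpace
open B15Eq112TorusCover (cover)
open B14DomainGeom (Pt)
open B7Prop1Local (InBox)
open BlockAveragingZd (ctrShift)
open B7SectEFLinearisationRec (blockSitesZ)
open B8Eq138LandauZdRec (IsLandau138Z)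
open B8Eq131Cubes (cube tLo tHi)
open B8Eq131CubesRec (cubeZ tcubeZ sqLoZ sqHiZ inLoZ inHiZ)
open B8Eq131CubesRecDictionary (inBox_sqZ_iff_add_ctrShift inBox_inZ_iff_add_ctrShift mem_cubeZ_iff_add_ctrShift)
open B8Eq119TwistedAxialRec (UnderZ underZ_tower)
open B8CubeMemberZd (cubeLam cubeLamS cubeLamS_top)
open Literature.MathematicalPhysics.QuantumLattice (blockSites)
open LatticeFieldCalculus (laplace diverg)
open B6SectADomainsV1 (Domains)
open B6SectAOperatorsV1 (ScalarSpace RE dsE lapE QpE RE_eq_zero_iff mem_ker_QpE_iff lapE_apply dsE_apply inner_eq_sum)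
open BalabanImbrieJaffe1984to88.BIJ85AxialPropagator411 (BondSpace)

variable {P : Params}

/-! ## §1  Over the constant family `□̃ᶻ` the dented cells are the pure cells; they translate onto the engine cells -/

section Cells

/-- ★ **THE CELLS OF `propCubePZ`** (`j ≤ k`): `z ∈ Λ′_j ↔ z ∈ □_j^{(j)}ᶻ ∧ (j < k → z ∉ □_{j+1}^{(j)}ᶻ)` — the two dent clauses of `CubeB8DZ.lamS` («the block over the label lies in `Ω_k`») are TRUE
when `Ω_k = □̃ᶻ`: a label of `□_k^{(k)}` ∕ of `□_k^{(k−1)}` has its centred block inside `□_kᶻ ⊆ □̃ᶻ` (dag-n05-d's `underZ_tower`, `inner_eq_blowup`).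
[cite: Balaban1985Variational, (148)–(150) p.301; Balaban1985RegularSpaces, (1.131) p.99, p.98; Balaban1987RG1, (0.3) p.252] -/
theorem mem_lamS_propCubePZ_iff {n : ℕ} (hn : 1 ≤ n) {M ρ : ℕ} (hρ : P.L ≤ ρ) (a : Pt P.d) {j : ℕ} (hj : j ≤ n) (z : Pt P.d) :
    z ∈ (propCubePZ P n hn M ρ hρ a).lamS j ↔
      InBox (sqLoZ P.L (cornerP P M ρ a) ρ n j) (sqHiZ P.L (cornerP P M ρ a) (sideP P M ρ) ρ n j) z ∧
        (j < n → ¬ InBox (inLoZ P.L (cornerP P M ρ a) ρ n j) (inHiZ P.L (cornerP P M ρ a) (sideP P M ρ) ρ n j) z) := by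
  have hLo : Odd P.L := P.hL.1
  have hL : 2 ≤ P.L := P.hL.2
  have hρ1 : 1 ≤ ρ := le_trans (le_trans (by norm_num) hL) hρ
  set c := propCubePZ P n hn M ρ hρ a with hc
  -- the top cube lies in `□̃ᶻ = Ω_k`
  have htop : cubeZ P.L (cornerP P M ρ a) (sideP P M ρ) ρ n n ⊆ tcubeZ P.L (cornerP P M ρ a) (sideP P M ρ) ρ n :=
    B8Eq131CubesRec.cube_subset_tcube hLo hL hρ1 le_rfl
  -- (F1) a label of `□_k^{(k)}` carries its centred `k`-block into `□_kᶻ`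
  have hF1 : ∀ w : Pt P.d, InBox (sqLoZ P.L (cornerP P M ρ a) ρ n n) (sqHiZ P.L (cornerP P M ρ a) (sideP P M ρ) ρ n n) w →
      ∀ x, UnderZ P.L n w x → x ∈ tcubeZ P.L (cornerP P M ρ a) (sideP P M ρ) ρ n :=
    fun w hw x hx => htop ((B8Eq131CubesRec.mem_cube_iff hLo).2 ⟨w, hw, hx⟩)
  -- (F2) a label of `□_k^{(k−1)}` carries its centred `(k−1)`-block into `□_kᶻ`
  have hF2 : ∀ w : Pt P.d, InBox (inLoZ P.L (cornerP P M ρ a) ρ n (n - 1)) (inHiZ P.L (cornerP P M ρ a) (sideP P M ρ) ρ n (n - 1)) w →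
      ∀ x, UnderZ P.L (n - 1) w x → x ∈ tcubeZ P.L (cornerP P M ρ a) (sideP P M ρ) ρ n := by
    intro w hw x hx
    have hlt : n - 1 < n := by omega
    obtain ⟨h1, h2⟩ := B8Eq131CubesRec.inner_eq_blowup hLo (cornerP P M ρ a) (sideP P M ρ) ρ hlt
    rw [show n - 1 + 1 = n by omega] at h1 h2
    rw [h1, h2] at hw
    have ht := underZ_tower hLo (m₀ := 1) (m := n - 1) (fun i => (hw i).1) (fun i => (hw i).2) hx
    rw [show 1 + (n - 1) = n by omega] at ht
    exact htop (B8Ineq130.inBox_of_le ht.1 ht.2)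
  simp only [CubeB8DZ.lamS, hc, propCubePZ_k, propCubePZ_a, propCubePZ_M, propCubePZ_ρ, if_pos hj, Set.mem_setOf_eq]
  constructor
  · rintro ⟨hsq, -, hin⟩
    refine ⟨hsq, fun hjn hbox => hin hjn ⟨hbox, fun hj1 x hx => ?_⟩⟩
    have : j = n - 1 := by omega
    subst this
    exact hF2 z hbox x hx
  · rintro ⟨hsq, hin⟩
    refine ⟨hsq, fun hjn x hx => ?_, fun hjn h => hin hjn h.1⟩
    subst hjn
    exact hF1 z hsq x hx

/-- ★ **THE RECORD CELLS TRANSLATE ONTO THE ENGINE CELLS** (`j ≤ k`): `z ∈ Λ′_j` of `propCubePZ` ⇒ `z + c_{k−j}·𝟙 ∈ cubeLamS L (cornerP) (sideP) ρ k k j` (N05's pure cells of the same datum,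
dag-n07-e's module-39 letters). [cite: Balaban1985RegularSpaces, (1.131) p.99; Balaban1987RG1, (0.3) p.252; Balaban1985Variational, (150) p.301] -/
theorem add_ctrShift_mem_cubeLamS_of_mem_lamS_propCubePZ {n : ℕ} (hn : 1 ≤ n) {M ρ : ℕ} (hρ : P.L ≤ ρ) (a : Pt P.d) {j : ℕ} (hj : j ≤ n) {z : Pt P.d}
    (hz : z ∈ (propCubePZ P n hn M ρ hρ a).lamS j) :
    (z + fun _ => (ctrShift P.L (n - j) : ℤ)) ∈ cubeLamS P.L (cornerP P M ρ a) (sideP P M ρ) ρ n n j := by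
  obtain ⟨hsq, hin⟩ := (mem_lamS_propCubePZ_iff hn hρ a hj z).1 hz
  rw [cubeLamS_top P.L _ _ _ hj]
  refine ⟨(inBox_sqZ_iff_add_ctrShift P.L _ _ _ _ _ z).1 hsq, fun hjn h => hin hjn ?_⟩
  exact (inBox_inZ_iff_add_ctrShift P.L _ _ _ _ _ z).2 h

end Cells

/-! ## §2  ★★★ The (153) pairing on the torus for every `μ ∈ N(Q′)` of the datum's torus tower -/

section Pairing

variable {𝔸 : Type*} [NormedRing 𝔸] [NormedAlgebra ℂ 𝔸] [CompleteSpace 𝔸]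

/-- ★★★ **[15] (153) ∕ [B6] (2.12) AT THE RECORD'S TORUS FROM THE RECORD's LANDAU FORM, FOR EVERY `μ ∈ N(Q′)` OF THE DATUM's TORUS TOWER, REAL PART.**  Data: the record datum
`c := propCubePZ P k hk₁ M ρ hρ a` (`k ≤ m + K`) whose engine `□₀ = cube L (cornerP) (sideP) ρ k 0` does not wrap; a torus potential `A` with `A ⟨π(x + c_k·𝟙), μ⟩ = A″ x μ` on `□₀ᶻ = c.sq 0`
and `IsLandau138Z L k η (c.sq 0) c.lamS 1 A″` (STAGE 2's seventh row).  Then for EVERY `μ` with `(cubeDomains P (cornerP …) (sideP …) ρ k hck).InGauge μ` and every `φ : 𝔸 →L[ℂ] ℂ`: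
`Σ_y (laplace η⁻¹ μ)(y)·(diverg η⁻¹ (Re(φ∘A)))(y) = 0`.  Rows: g9's FILE 44 at `t := c_k·𝟙`, `X := □₀` (engine), `S := □₁` (engine), `h0 ∕ hQ` from dag-n07-e's `rows153_h0∕hQ_cubeDomains`
at the translated labels (§1). [cite: Balaban1985Variational, (153) p.301, p.302; Balaban1985RegularSpaces, (1.38) p.82, (1.131) p.99; Balaban1984PropagatorsII, (2.7) p.224, (2.10)–(2.12) p.225; Balaban1987RG1, (0.3) p.252] -/
theorem sum_laplace_mul_diverg_re_eq_zero_of_isLandau138Z_propCubePZ {k : ℕ} (hk₁ : 1 ≤ k) {M ρ : ℕ} (hρ : P.L ≤ ρ) (a : Pt P.d)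
    (hck : k ≤ P.m + P.K) (hinj : Set.InjOn (cover P) (cube P.L (cornerP P M ρ a) (sideP P M ρ) ρ k 0)) {η : ℝ}
    {A'' : Pt P.d → Fin P.d → 𝔸} {A : PBond P 0 → 𝔸}
    (hA : ∀ x, x ∈ (propCubePZ P k hk₁ M ρ hρ a).sq 0 → ∀ κ, A ⟨cover P (x + fun _ => (ctrShift P.L k : ℤ)), κ⟩ = A'' x κ)
    (hLan : IsLandau138Z P.L k η ((propCubePZ P k hk₁ M ρ hρ a).sq 0) (propCubePZ P k hk₁ M ρ hρ a).lamS
      (1 : B7Prop1Explicit.Site P.d → Fin P.d → 𝔸ˣ) A'')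
    {μ : SiteField P 0 ℝ} (hμ : (cubeDomains P (cornerP P M ρ a) (sideP P M ρ) ρ k hck).InGauge μ) (φ : 𝔸 →L[ℂ] ℂ) :
    ∑ y : Site P 0, laplace η⁻¹ μ y * diverg η⁻¹ (fun b => (φ (A b)).re) y = 0 := by
  have hLo : Odd P.L := P.hL.1
  set c := propCubePZ P k hk₁ M ρ hρ a with hc
  set X : Set (Pt P.d) := cube P.L (cornerP P M ρ a) (sideP P M ρ) ρ k 0 with hX
  -- the record `□₀ᶻ` and the engine `□₀`
  have hsq0 : c.sq 0 = cubeZ P.L (cornerP P M ρ a) (sideP P M ρ) ρ k 0 := c.sq_zero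
  have h0X : ∀ x : Pt P.d, x ∈ c.sq 0 ↔ (x + fun _ => (ctrShift P.L k : ℤ)) ∈ X := fun x => by
    rw [hsq0]; exact mem_cubeZ_iff_add_ctrShift hLo _ _ _ (Nat.zero_le k) x
  have hXΩ : X ⊆ (fun y => y + fun _ => ((ctrShift P.L k : ℕ) : ℤ)) '' c.sq 0 := fun y hy =>
    ⟨y - fun _ => (ctrShift P.L k : ℤ), (h0X _).2 (by rwa [sub_add_cancel]), sub_add_cancel y _⟩
  have hfin : (c.sq 0).Finite := by
    have hXfin : X.Finite := by
      rw [hX, ← B8Eq131CubesAdmissible.cubeFam_false_zero]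
      exact B8Eq191FlatLettersCubeMember.cubeFam_zero_finite P.L _ _ _ _
    refine (hXfin.preimage (Set.injOn_of_injective (add_left_injective (fun _ => (ctrShift P.L k : ℤ))))).subset fun x hx => ?_
    exact (h0X x).1 hx
  have hA' : ∀ z, z ∈ X → ∀ κ, A ⟨cover P z, κ⟩ = A'' (z - fun _ => ((ctrShift P.L k : ℕ) : ℤ)) κ := by
    intro z hz κ
    have h := hA (z - fun _ => (ctrShift P.L k : ℤ)) ((h0X _).2 (by rwa [sub_add_cancel])) κ
    rwa [sub_add_cancel] at h
  -- the engine cube `CubeB8.ofUniv` of the same numbers, for N05's collar lemma `□₁ + 2 ⊆ □₀`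
  set c' : CubeB8 P.d P.L k (fun _ => (Set.univ : Set (B7Prop1Explicit.Site P.d))) :=
    CubeB8.ofUniv k (cornerP P M ρ a) (sideP P M ρ) ρ hk₁ le_rfl hρ c.ρ_le_M c.big c.L_le_dM rfl rfl with hc'
  have hc'0 : c'.sq 0 = X := B8Eq131CubesAdmissible.cubeFam_false_zero P.L _ _ _ _
  have hS : ∀ s ∈ cube P.L (cornerP P M ρ a) (sideP P M ρ) ρ k 1, ∀ z : Pt P.d, (∀ i, |z i - s i| ≤ 2) → z ∈ X := fun s hs z hz => by
    rw [← hc'0]; exact mem_sq_zero_of_near_sq_one c' hs hz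
  refine sum_laplace_mul_diverg_re_eq_zero_of_isLandau138Z_cover hLo hfin hLan _ hXΩ hinj hA'
    (support_row_cubeDomains (hk := hck) hk₁ hμ) hS (fun x hx => ?_) (fun j hj hjk y hy => ?_) φ
  · -- row (h0): at a level-0 record cell `x`, the pull-back vanishes (or `x + c_k ∉ □₀`)
    by_cases hxX : (x + fun _ => ((ctrShift P.L k : ℕ) : ℤ)) ∈ X
    · rw [Set.indicator_of_mem hxX]
      have hlam := add_ctrShift_mem_cubeLamS_of_mem_lamS_propCubePZ hk₁ hρ a (Nat.zero_le k) hx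
      rw [Nat.sub_zero] at hlam
      rw [rows153_h0_cubeDomains (hk := hck) hinj hk₁ hμ _ hxX hlam, Complex.ofReal_zero]
    · rw [Set.indicator_of_notMem hxX]
  · -- row (hQ): at a level-`j` record cell `y`, the centred block sum of the pull-back vanishes
    rw [sum_blockSitesZ_add_ctrShift hjk y]
    have hlam := add_ctrShift_mem_cubeLamS_of_mem_lamS_propCubePZ hk₁ hρ a hjk hy
    have h := rows153_hQ_cubeDomains (hk := hck) hinj hμ j hj hjk _ hlam
    have hcast : ∀ x : Pt P.d, X.indicator (fun z => ((μ (cover P z) : ℝ) : ℂ)) x = ((X.indicator (fun z => μ (cover P z)) x : ℝ) : ℂ) := fun x => by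
      by_cases hx : x ∈ X
      · rw [Set.indicator_of_mem hx, Set.indicator_of_mem hx]
      · rw [Set.indicator_of_notMem hx, Set.indicator_of_notMem hx, Complex.ofReal_zero]
    simp_rw [hcast, ← Complex.ofReal_sum]
    rw [hX, h, Complex.ofReal_zero]

/-- ★★★ **The same, IMAGINARY PART** (`a := Im(φ ∘ A)`). [cite: Balaban1985Variational, (153) p.301; Balaban1984PropagatorsII, (2.7) p.224, (2.12) p.225; Balaban1987RG1, (0.3) p.252] -/
theorem sum_laplace_mul_diverg_im_eq_zero_of_isLandau138Z_propCubePZ {k : ℕ} (hk₁ : 1 ≤ k) {M ρ : ℕ} (hρ : P.L ≤ ρ) (a : Pt P.d)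
    (hck : k ≤ P.m + P.K) (hinj : Set.InjOn (cover P) (cube P.L (cornerP P M ρ a) (sideP P M ρ) ρ k 0)) {η : ℝ}
    {A'' : Pt P.d → Fin P.d → 𝔸} {A : PBond P 0 → 𝔸}
    (hA : ∀ x, x ∈ (propCubePZ P k hk₁ M ρ hρ a).sq 0 → ∀ κ, A ⟨cover P (x + fun _ => (ctrShift P.L k : ℤ)), κ⟩ = A'' x κ)
    (hLan : IsLandau138Z P.L k η ((propCubePZ P k hk₁ M ρ hρ a).sq 0) (propCubePZ P k hk₁ M ρ hρ a).lamS
      (1 : B7Prop1Explicit.Site P.d → Fin P.d → 𝔸ˣ) A'')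
    {μ : SiteField P 0 ℝ} (hμ : (cubeDomains P (cornerP P M ρ a) (sideP P M ρ) ρ k hck).InGauge μ) (φ : 𝔸 →L[ℂ] ℂ) :
    ∑ y : Site P 0, laplace η⁻¹ μ y * diverg η⁻¹ (fun b => (φ (A b)).im) y = 0 := by
  have hLo : Odd P.L := P.hL.1
  set c := propCubePZ P k hk₁ M ρ hρ a with hc
  set X : Set (Pt P.d) := cube P.L (cornerP P M ρ a) (sideP P M ρ) ρ k 0 with hX
  have hsq0 : c.sq 0 = cubeZ P.L (cornerP P M ρ a) (sideP P M ρ) ρ k 0 := c.sq_zero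
  have h0X : ∀ x : Pt P.d, x ∈ c.sq 0 ↔ (x + fun _ => (ctrShift P.L k : ℤ)) ∈ X := fun x => by
    rw [hsq0]; exact mem_cubeZ_iff_add_ctrShift hLo _ _ _ (Nat.zero_le k) x
  have hXΩ : X ⊆ (fun y => y + fun _ => ((ctrShift P.L k : ℕ) : ℤ)) '' c.sq 0 := fun y hy =>
    ⟨y - fun _ => (ctrShift P.L k : ℤ), (h0X _).2 (by rwa [sub_add_cancel]), sub_add_cancel y _⟩
  have hfin : (c.sq 0).Finite := by
    have hXfin : X.Finite := by
      rw [hX, ← B8Eq131CubesAdmissible.cubeFam_false_zero]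
      exact B8Eq191FlatLettersCubeMember.cubeFam_zero_finite P.L _ _ _ _
    refine (hXfin.preimage (Set.injOn_of_injective (add_left_injective (fun _ => (ctrShift P.L k : ℤ))))).subset fun x hx => ?_
    exact (h0X x).1 hx
  have hA' : ∀ z, z ∈ X → ∀ κ, A ⟨cover P z, κ⟩ = A'' (z - fun _ => ((ctrShift P.L k : ℕ) : ℤ)) κ := by
    intro z hz κ
    have h := hA (z - fun _ => (ctrShift P.L k : ℤ)) ((h0X _).2 (by rwa [sub_add_cancel])) κ
    rwa [sub_add_cancel] at h
  set c' : CubeB8 P.d P.L k (fun _ => (Set.univ : Set (B7Prop1Explicit.Site P.d))) :=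
    CubeB8.ofUniv k (cornerP P M ρ a) (sideP P M ρ) ρ hk₁ le_rfl hρ c.ρ_le_M c.big c.L_le_dM rfl rfl with hc'
  have hc'0 : c'.sq 0 = X := B8Eq131CubesAdmissible.cubeFam_false_zero P.L _ _ _ _
  have hS : ∀ s ∈ cube P.L (cornerP P M ρ a) (sideP P M ρ) ρ k 1, ∀ z : Pt P.d, (∀ i, |z i - s i| ≤ 2) → z ∈ X := fun s hs z hz => by
    rw [← hc'0]; exact mem_sq_zero_of_near_sq_one c' hs hz
  refine sum_laplace_mul_diverg_im_eq_zero_of_isLandau138Z_cover hLo hfin hLan _ hXΩ hinj hA'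
    (support_row_cubeDomains (hk := hck) hk₁ hμ) hS (fun x hx => ?_) (fun j hj hjk y hy => ?_) φ
  · by_cases hxX : (x + fun _ => ((ctrShift P.L k : ℕ) : ℤ)) ∈ X
    · rw [Set.indicator_of_mem hxX]
      have hlam := add_ctrShift_mem_cubeLamS_of_mem_lamS_propCubePZ hk₁ hρ a (Nat.zero_le k) hx
      rw [Nat.sub_zero] at hlam
      rw [rows153_h0_cubeDomains (hk := hck) hinj hk₁ hμ _ hxX hlam, Complex.ofReal_zero]
    · rw [Set.indicator_of_notMem hxX]
  · rw [sum_blockSitesZ_add_ctrShift hjk y]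
    have hlam := add_ctrShift_mem_cubeLamS_of_mem_lamS_propCubePZ hk₁ hρ a hjk hy
    have h := rows153_hQ_cubeDomains (hk := hck) hinj hμ j hj hjk _ hlam
    have hcast : ∀ x : Pt P.d, X.indicator (fun z => ((μ (cover P z) : ℝ) : ℂ)) x = ((X.indicator (fun z => μ (cover P z)) x : ℝ) : ℂ) := fun x => by
      by_cases hx : x ∈ X
      · rw [Set.indicator_of_mem hx, Set.indicator_of_mem hx]
      · rw [Set.indicator_of_notMem hx, Set.indicator_of_notMem hx, Complex.ofReal_zero]
    simp_rw [hcast, ← Complex.ofReal_sum]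
    rw [hX, h, Complex.ofReal_zero]

end Pairing

/-! ## §3  ★★★ In p21's letters: `RE (cubeDomains …) η⁻¹ (dsE η⁻¹ a) = 0`, and at every kernel-finer family (N07's meet) -/

section Last

variable {N : ℕ}

/-- ★★★ **[15] (153) IN p21's LETTERS, REAL PART, RECORD DATUM**: under the data of §2 (with `𝔸 = M_N(ℂ)`), for every `φ` the real bond function `a := Re(φ ∘ A)` satisfies `R ∂*a = 0`
with `R = RE (cubeDomains P (cornerP …) (sideP …) ρ k hck) η⁻¹` ([B6] (2.12)). [cite: Balaban1985Variational, (153) p.301; Balaban1985RegularSpaces, (1.38) p.82; Balaban1984PropagatorsII, (2.7) p.224, (2.10)–(2.12) p.225; Balaban1987RG1, (0.3) p.252] -/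
theorem RE_dsE_re_eq_zero_of_isLandau138Z_propCubePZ {k : ℕ} (hk₁ : 1 ≤ k) {M ρ : ℕ} (hρ : P.L ≤ ρ) (a : Pt P.d)
    (hck : k ≤ P.m + P.K) (hinj : Set.InjOn (cover P) (cube P.L (cornerP P M ρ a) (sideP P M ρ) ρ k 0)) {η : ℝ}
    {A'' : Pt P.d → Fin P.d → MatA N} {A : PBond P 0 → MatA N}
    (hA : ∀ x, x ∈ (propCubePZ P k hk₁ M ρ hρ a).sq 0 → ∀ κ, A ⟨cover P (x + fun _ => (ctrShift P.L k : ℤ)), κ⟩ = A'' x κ)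
    (hLan : IsLandau138Z P.L k η ((propCubePZ P k hk₁ M ρ hρ a).sq 0) (propCubePZ P k hk₁ M ρ hρ a).lamS
      (1 : B7Prop1Explicit.Site P.d → Fin P.d → (MatA N)ˣ) A'')
    (φ : MatA N →L[ℂ] ℂ) :
    RE (cubeDomains P (cornerP P M ρ a) (sideP P M ρ) ρ k hck) η⁻¹ (dsE η⁻¹ (WithLp.toLp 2 fun b => (φ (A b)).re : BondSpace P)) = 0 := by
  rw [RE_eq_zero_iff]
  intro v hv
  rw [mem_ker_QpE_iff] at hv
  rw [inner_eq_sum]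
  simp_rw [lapE_apply, dsE_apply]
  exact sum_laplace_mul_diverg_re_eq_zero_of_isLandau138Z_propCubePZ hk₁ hρ a hck hinj hA hLan hv φ

/-- ★★★ **The same, IMAGINARY PART** (`a := Im(φ ∘ A)`). [cite: Balaban1985Variational, (153) p.301; Balaban1984PropagatorsII, (2.7) p.224, (2.12) p.225; Balaban1987RG1, (0.3) p.252] -/
theorem RE_dsE_im_eq_zero_of_isLandau138Z_propCubePZ {k : ℕ} (hk₁ : 1 ≤ k) {M ρ : ℕ} (hρ : P.L ≤ ρ) (a : Pt P.d)
    (hck : k ≤ P.m + P.K) (hinj : Set.InjOn (cover P) (cube P.L (cornerP P M ρ a) (sideP P M ρ) ρ k 0)) {η : ℝ}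
    {A'' : Pt P.d → Fin P.d → MatA N} {A : PBond P 0 → MatA N}
    (hA : ∀ x, x ∈ (propCubePZ P k hk₁ M ρ hρ a).sq 0 → ∀ κ, A ⟨cover P (x + fun _ => (ctrShift P.L k : ℤ)), κ⟩ = A'' x κ)
    (hLan : IsLandau138Z P.L k η ((propCubePZ P k hk₁ M ρ hρ a).sq 0) (propCubePZ P k hk₁ M ρ hρ a).lamS
      (1 : B7Prop1Explicit.Site P.d → Fin P.d → (MatA N)ˣ) A'')
    (φ : MatA N →L[ℂ] ℂ) :
    RE (cubeDomains P (cornerP P M ρ a) (sideP P M ρ) ρ k hck) η⁻¹ (dsE η⁻¹ (WithLp.toLp 2 fun b => (φ (A b)).im : BondSpace P)) = 0 := by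
  rw [RE_eq_zero_iff]
  intro v hv
  rw [mem_ker_QpE_iff] at hv
  rw [inner_eq_sum]
  simp_rw [lapE_apply, dsE_apply]
  exact sum_laplace_mul_diverg_im_eq_zero_of_isLandau138Z_propCubePZ hk₁ hρ a hck hinj hA hLan hv φ

/-- ★★★ **(153) AT EVERY KERNEL-FINER FAMILY, RECORD DATUM** — in particular at N07's meet `domainsMeet (cubeDomains …) D₂` with the run's family ([15] (150) «Ω′_j = □_j ∩ Ω_j»; dag-n07-e's
`ker_QpE_le_of_domainsLe (domainsMeet_le_left _ _)`): both `RE D′ η⁻¹ (dsE η⁻¹ (Re(φ∘A))) = 0` and `… (Im(φ∘A)) … = 0` whenever `ker Q′_{D′} ≤ ker Q′_{cubeDomains …}` — the shape of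
`HThm4Rec`'s (153) row. [cite: Balaban1985Variational, (150)–(153) p.301; Balaban1984PropagatorsII, (2.10)–(2.12) p.225; Balaban1987RG1, (0.3) p.252] -/
theorem RE_dsE_re_im_eq_zero_of_ker_le_of_isLandau138Z_propCubePZ {k : ℕ} (hk₁ : 1 ≤ k) {M ρ : ℕ} (hρ : P.L ≤ ρ) (a : Pt P.d)
    (hck : k ≤ P.m + P.K) (hinj : Set.InjOn (cover P) (cube P.L (cornerP P M ρ a) (sideP P M ρ) ρ k 0)) {η : ℝ}
    {A'' : Pt P.d → Fin P.d → MatA N} {A : PBond P 0 → MatA N}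
    (hA : ∀ x, x ∈ (propCubePZ P k hk₁ M ρ hρ a).sq 0 → ∀ κ, A ⟨cover P (x + fun _ => (ctrShift P.L k : ℤ)), κ⟩ = A'' x κ)
    (hLan : IsLandau138Z P.L k η ((propCubePZ P k hk₁ M ρ hρ a).sq 0) (propCubePZ P k hk₁ M ρ hρ a).lamS
      (1 : B7Prop1Explicit.Site P.d → Fin P.d → (MatA N)ˣ) A'')
    {D' : Domains P} (hD' : LinearMap.ker (QpE D') ≤ LinearMap.ker (QpE (cubeDomains P (cornerP P M ρ a) (sideP P M ρ) ρ k hck)))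
    (φ : MatA N →L[ℂ] ℂ) :
    RE D' η⁻¹ (dsE η⁻¹ (WithLp.toLp 2 fun b => (φ (A b)).re : BondSpace P)) = 0 ∧
      RE D' η⁻¹ (dsE η⁻¹ (WithLp.toLp 2 fun b => (φ (A b)).im : BondSpace P)) = 0 :=
  ⟨RE_eq_zero_of_ker_le hD' (RE_dsE_re_eq_zero_of_isLandau138Z_propCubePZ hk₁ hρ a hck hinj hA hLan φ),
    RE_eq_zero_of_ker_le hD' (RE_dsE_im_eq_zero_of_isLandau138Z_propCubePZ hk₁ hρ a hck hinj hA hLan φ)⟩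

/-- ★★★ **(153) AT THE MEET WITH ANY SECOND FAMILY** `domainsMeet (cubeDomains …) D₂` — `HThm4Rec`'s row at `D₂ := domainsOfSeq s.Ω k hck`.
[cite: Balaban1985Variational, (150)–(153) p.301; Balaban1984PropagatorsII, (2.10)–(2.12) p.225; Balaban1987RG1, (0.3) p.252] -/
theorem RE_dsE_re_im_eq_zero_meet_of_isLandau138Z_propCubePZ {k : ℕ} (hk₁ : 1 ≤ k) {M ρ : ℕ} (hρ : P.L ≤ ρ) (a : Pt P.d)
    (hck : k ≤ P.m + P.K) (hinj : Set.InjOn (cover P) (cube P.L (cornerP P M ρ a) (sideP P M ρ) ρ k 0)) {η : ℝ}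
    {A'' : Pt P.d → Fin P.d → MatA N} {A : PBond P 0 → MatA N}
    (hA : ∀ x, x ∈ (propCubePZ P k hk₁ M ρ hρ a).sq 0 → ∀ κ, A ⟨cover P (x + fun _ => (ctrShift P.L k : ℤ)), κ⟩ = A'' x κ)
    (hLan : IsLandau138Z P.L k η ((propCubePZ P k hk₁ M ρ hρ a).sq 0) (propCubePZ P k hk₁ M ρ hρ a).lamS
      (1 : B7Prop1Explicit.Site P.d → Fin P.d → (MatA N)ˣ) A'')
    (D₂ : Domains P) (φ : MatA N →L[ℂ] ℂ) :
    RE (domainsMeet (cubeDomains P (cornerP P M ρ a) (sideP P M ρ) ρ k hck) D₂) η⁻¹ (dsE η⁻¹ (WithLp.toLp 2 fun b => (φ (A b)).re : BondSpace P)) = 0 ∧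
      RE (domainsMeet (cubeDomains P (cornerP P M ρ a) (sideP P M ρ) ρ k hck) D₂) η⁻¹ (dsE η⁻¹ (WithLp.toLp 2 fun b => (φ (A b)).im : BondSpace P)) = 0 :=
  RE_dsE_re_im_eq_zero_of_ker_le_of_isLandau138Z_propCubePZ hk₁ hρ a hck hinj hA hLan
    (ker_QpE_le_of_domainsLe (domainsMeet_le_left _ D₂)) φ

end Last

end Literature.MathematicalPhysics.QuantumFieldTheory.Balaban1983to89.Node00

end

/-! ## Axiom audit (gate whitelist: `propext`, `Classical.choice`, `Quot.sound`) -/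
#print axioms Literature.MathematicalPhysics.QuantumFieldTheory.Balaban1983to89.Node00.RE_dsE_re_im_eq_zero_meet_of_isLandau138Z_propCubePZ
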